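import Mathlib
import Summits.RiemannHypothesis.RiemannHypothesis.Theorems.WeilParityOffLineParityDetectionStubBohrTransfer
import Summits.RiemannHypothesis.RiemannHypothesis.Theorems.WeilParityOffLineParityDetectionLocLaplace
import Summits.RiemannHypothesis.RiemannHypothesis.Theorems.WeilParityOffLineParityDetectionLocProfile
import HarnessLib

/-!
# Half-line Laplace integrals in the low-ordinate torus regime (helper file for stub TORUS-LOW)

Route `WeilParity`, crux `OffLineParityDetection` (item stmt-RiemannHypothesis-15431), line
`registered`, stub `stub_torusTopHeavyLowOrdinates` (TORUS-LOW; TORUS-analysis §5.3, Theorem LOW).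
Pure real/complex analysis on the half line `(0, ∞)`: no zeta facts, no Weil tests, no
definitions.  With the Laplace integral `F_f(ρ) = ∫₀^∞ f(u) e^{-(ρ-1/2)u} du` (always written out as
`∫ u in Set.Ioi 0, (f u : ℂ) * Complex.exp (-((ρ - 1/2) * u))`) at a point `ρ` of the top layer,
`Re ρ = 1/2 + η`, `γ = Im ρ`, this file provides:

* `torusLow_integral_sq_mul_exp` — Euler's integral `∫₀^∞ (ηu e^{-ηu})² du = 1/(4η)`;
* `torusLow_danger` (registered sub-goal of the item, closed form) — the DANGER BOUND of the low
  regime `|γ| ≤ η`: `-Re F_f(ρ)² ≤ ‖f‖²/(4η)` for every continuous compactly supported real `f`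
  (`-Re F² ≤ (Im F)²`, `Im F_f(ρ) = -∫ f e^{-ηu} sin(γu)`, `|sin(γu)| ≤ ηu`, Cauchy–Schwarz);
* `torusLow_lap_exp` — the ideal profile's transform `∫₀^∞ e^{-bu} e^{-wu} du = 1/(b + w)`;
* `torusLow_ideal_bounds` — for `c = 3η + iγ`, `|γ| ≤ η`: `η² Re (1/c)² ≥ 2/25` and
  `η ‖1/c‖ ≤ 1/3` (the test vector `e^{-2ηu}` has `F(ρ) = 1/(3η + iγ)`);
* `torusLow_trunc_error` — cutting the ideal profile off by a plateau function `φ`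
  (`0 ≤ φ ≤ 1`, `φ = 1` on `[ε, U]`) costs `‖∫₀^∞ (1 - φ) e^{-2ηu} e^{-wu} du‖ ≤ e·ε + e^{-2ηU}/η`.

Everything is folklore calculus and fully proved (Mathlib: `integral_exp_mul_complex_Ioi`,
`Real.integral_rpow_mul_exp_neg_mul_Ioi`; tree: `sq_integral_mul_le`,
`loc_integrable_lapIntegrand`).  The stub itself (danger bound summed over the layer, the smooth
gaining profile `φ(u) e^{-2ηu}`, gain `≥ (2/25 - 1/150 - 10⁻⁴)(Σ w)/η² ≥ (13/200)(Σ w)/η²`) is in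
`WeilParityOffLineParityDetectionStubTorusTopHeavyLowOrdinates.lean`.
-/

set_option linter.dupNamespace false

noncomputable section

namespace Summit.RiemannHypothesis.RiemannHypothesis.Theorems.WeilParityOffLineParityDetection

open MeasureTheory Set Filter
open scoped ComplexConjugate
open Literature.NumberTheory.LFunctions

/-! ## Euler's integral and the danger bound -/

/-- `∫₀^∞ (η u e^{-ηu})² du = 1/(4η)` for `η > 0` (Euler: `∫₀^∞ u² e^{-2ηu} du = Γ(3)/(2η)³`).
[folklore] -/
theorem torusLow_integral_sq_mul_exp {η : ℝ} (hη : 0 < η) :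
    ∫ u in Ioi (0 : ℝ), (η * u * Real.exp (-(η * u))) ^ 2 = 1 / (4 * η) := by
  have h := Real.integral_rpow_mul_exp_neg_mul_Ioi (a := 3) (r := 2 * η) (by norm_num)
    (by positivity)
  have hG : Real.Gamma 3 = 2 := by
    rw [show (3 : ℝ) = (2 : ℕ) + 1 by norm_num, Real.Gamma_nat_eq_factorial]
    norm_num [Nat.factorial]
  have e : ∀ u ∈ Ioi (0 : ℝ), (η * u * Real.exp (-(η * u))) ^ 2 =
      η ^ 2 * (u ^ ((3 : ℝ) - 1) * Real.exp (-(2 * η * u))) := by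
    intro u _
    rw [show (3 : ℝ) - 1 = 2 by norm_num, Real.rpow_two, mul_pow, mul_pow, sq (Real.exp _),
      ← Real.exp_add]
    ring_nf
  rw [setIntegral_congr_fun measurableSet_Ioi e, integral_const_mul, h, hG,
    show (3 : ℝ) = ((3 : ℕ) : ℝ) by norm_num, Real.rpow_natCast]
  field_simp
  ring

/-- **Danger bound in the low-ordinate regime** (registered sub-goal of the item, closed form).
For continuous compactly supported real `f`, `η > 0`, `Re ρ = 1/2 + η` and `|Im ρ| ≤ η`:
`-Re F_f(ρ)² ≤ ‖f‖²/(4η)` where `F_f(ρ) = ∫₀^∞ f(u) e^{-(ρ-1/2)u} du`, `‖f‖² = ∫₀^∞ f²`.  Indeed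
`-Re F² ≤ (Im F)²`, `Im F_f(ρ) = -∫₀^∞ f e^{-ηu} sin(γu) du`, `|sin(γu)| ≤ |γ|u ≤ ηu` on `u > 0`,
Cauchy–Schwarz on `(0, ∞)` and `∫₀^∞ η²u²e^{-2ηu} du = 1/(4η)`. [folklore] -/
theorem torusLow_danger :
    ∀ (f : ℝ → ℝ), Continuous f → HasCompactSupport f → ∀ (η : ℝ), 0 < η → ∀ (ρ : ℂ),
      ρ.re = 1 / 2 + η → |ρ.im| ≤ η →
      -((∫ u in Set.Ioi (0 : ℝ), (f u : ℂ) * Complex.exp (-((ρ - 1 / 2) * (u : ℂ)))) ^ 2).re ≤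
        1 / (4 * η) * ∫ u in Set.Ioi (0 : ℝ), f u ^ 2 := by
  intro f hf hs η hη ρ hρ hγ
  set L := ∫ u in Ioi (0 : ℝ), (f u : ℂ) * Complex.exp (-((ρ - 1 / 2) * (u : ℂ))) with hL
  have hre : (L ^ 2).re = L.re ^ 2 - L.im ^ 2 := by
    rw [sq, Complex.mul_re]
    ring
  have hint := loc_integrable_lapIntegrand hf hs (ρ - 1 / 2)
  have him : L.im = ∫ u in Ioi (0 : ℝ), f u * (Real.exp (-(η * u)) * Real.sin (-(ρ.im * u))) := by
    rw [hL, ← RCLike.im_to_complex, ← integral_im hint.integrableOn]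
    refine setIntegral_congr_fun measurableSet_Ioi fun u _ ↦ ?_
    have h1 : (-((ρ - 1 / 2) * (u : ℂ))).re = -(η * u) := by
      simp [Complex.mul_re, hρ]
    have h2 : (-((ρ - 1 / 2) * (u : ℂ))).im = -(ρ.im * u) := by
      simp [Complex.mul_im]
    rw [RCLike.im_to_complex, Complex.im_ofReal_mul, Complex.exp_im, h1, h2]
  set k : ℝ → ℝ := fun u ↦ η * u * Real.exp (-(η * u)) with hk
  have hfk : Integrable (fun u ↦ ‖f u‖ * k u) (volume.restrict (Ioi (0 : ℝ))) :=
    ((hf.norm.mul (by fun_prop)).integrable_of_hasCompactSupport hs.norm.mul_right).integrableOn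
  have hbound : |L.im| ≤ ∫ u in Ioi (0 : ℝ), ‖f u‖ * k u := by
    rw [him, ← Real.norm_eq_abs]
    refine norm_integral_le_of_norm_le hfk ((ae_restrict_mem measurableSet_Ioi).mono fun u hu ↦ ?_)
    have hu : (0 : ℝ) < u := hu
    have hsin : |Real.sin (-(ρ.im * u))| ≤ η * u := by
      refine Real.abs_sin_le_abs.trans ?_
      rw [abs_neg, abs_mul, abs_of_pos hu]
      exact mul_le_mul_of_nonneg_right hγ hu.le
    rw [norm_mul, norm_mul, Real.norm_eq_abs (Real.exp _), abs_of_pos (Real.exp_pos _),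
      Real.norm_eq_abs (Real.sin _)]
    calc ‖f u‖ * (Real.exp (-(η * u)) * |Real.sin (-(ρ.im * u))|)
        ≤ ‖f u‖ * (Real.exp (-(η * u)) * (η * u)) := by gcongr
      _ = ‖f u‖ * k u := by simp only [hk]; ring
  have hf2 : Integrable (fun u ↦ ‖f u‖ ^ 2) (volume.restrict (Ioi (0 : ℝ))) := by
    have e : (fun u ↦ ‖f u‖ ^ 2) = fun u ↦ f u ^ 2 :=
      funext fun u ↦ by rw [Real.norm_eq_abs, sq_abs]
    rw [e]
    exact (loc_integrable_sq hf hs).integrableOn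
  have hkv : ∫ u in Ioi (0 : ℝ), k u ^ 2 = 1 / (4 * η) := torusLow_integral_sq_mul_exp hη
  have hk2 : Integrable (fun u ↦ k u ^ 2) (volume.restrict (Ioi (0 : ℝ))) :=
    Integrable.of_integral_ne_zero (by rw [hkv]; positivity)
  have hCS := sq_integral_mul_le hf2 hk2 hfk
  have hn2 : ∫ u in Ioi (0 : ℝ), ‖f u‖ ^ 2 = ∫ u in Ioi (0 : ℝ), f u ^ 2 := by
    simp_rw [Real.norm_eq_abs, sq_abs]
  have hIm : L.im ^ 2 ≤ 1 / (4 * η) * ∫ u in Ioi (0 : ℝ), f u ^ 2 := by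
    calc L.im ^ 2 = |L.im| ^ 2 := (sq_abs _).symm
      _ ≤ (∫ u in Ioi (0 : ℝ), ‖f u‖ * k u) ^ 2 := pow_le_pow_left₀ (abs_nonneg _) hbound 2
      _ ≤ (∫ u in Ioi (0 : ℝ), ‖f u‖ ^ 2) * ∫ u in Ioi (0 : ℝ), k u ^ 2 := hCS
      _ = 1 / (4 * η) * ∫ u in Ioi (0 : ℝ), f u ^ 2 := by rw [hkv, hn2, mul_comm]
  rw [hre]
  nlinarith [sq_nonneg L.re]

/-! ## The ideal profile `e^{-2ηu}` and its truncation -/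

/-- `∫₀^∞ e^{-bu} e^{-wu} du = 1/(b + w)` for real `b` with `b + Re w > 0`. [folklore] -/
theorem torusLow_lap_exp {b : ℝ} {w : ℂ} (h : 0 < b + w.re) :
    ∫ u in Ioi (0 : ℝ), ((Real.exp (-(b * u)) : ℝ) : ℂ) * Complex.exp (-(w * (u : ℂ))) =
      1 / ((b : ℂ) + w) := by
  have ha : (-((b : ℂ) + w)).re < 0 := by
    simp
    linarith
  have e : ∀ u : ℝ, ((Real.exp (-(b * u)) : ℝ) : ℂ) * Complex.exp (-(w * (u : ℂ))) =
      Complex.exp (-((b : ℂ) + w) * u) := by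
    intro u
    rw [Complex.ofReal_exp, ← Complex.exp_add]
    congr 1
    push_cast
    ring
  simp_rw [e]
  rw [integral_exp_mul_complex_Ioi ha 0, Complex.ofReal_zero, mul_zero, Complex.exp_zero,
    neg_div_neg_eq]

/-- For `Re c = 3η`, `|Im c| ≤ η`, `η > 0`: `η² Re (1/c)² ≥ 2/25` and `η ‖1/c‖ ≤ 1/3`
(`Re (1/c)² = (9η² - γ²)/(9η² + γ²)²`, minimal at `γ² = η²`). [folklore] -/
theorem torusLow_ideal_bounds {η : ℝ} (hη : 0 < η) {c : ℂ} (hre : c.re = 3 * η) (him : |c.im| ≤ η) :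
    2 / 25 ≤ η ^ 2 * ((1 / c) ^ 2).re ∧ η * ‖1 / c‖ ≤ 1 / 3 := by
  have hN : Complex.normSq c = 9 * η ^ 2 + c.im ^ 2 := by
    rw [Complex.normSq_apply, hre]
    ring
  have hsq : c.im ^ 2 ≤ η ^ 2 := sq_le_sq' (abs_le.1 him).1 (abs_le.1 him).2
  have hc0 : c ≠ 0 := by
    intro h0
    rw [h0] at hre
    simp at hre
    linarith
  constructor
  · have hA : ((1 / c) ^ 2).re = (9 * η ^ 2 - c.im ^ 2) / (9 * η ^ 2 + c.im ^ 2) ^ 2 := by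
      rw [one_div, sq, Complex.mul_re, Complex.inv_re, Complex.inv_im, hN, hre]
      have hp : (0 : ℝ) < 9 * η ^ 2 + c.im ^ 2 := by positivity
      field_simp
      ring
    rw [hA, mul_div_assoc', le_div_iff₀ (by positivity)]
    nlinarith [mul_nonneg (sub_nonneg.2 hsq) (by positivity : (0 : ℝ) ≤ 63 * η ^ 2 + 2 * c.im ^ 2),
      sq_nonneg η, sq_nonneg c.im]
  · have h3 : 3 * η ≤ ‖c‖ := by
      calc 3 * η = |c.re| := by rw [hre, abs_of_pos (by positivity)]
        _ ≤ ‖c‖ := Complex.abs_re_le_norm c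
    rw [norm_div, norm_one, ← div_eq_mul_one_div, div_le_div_iff₀ (by positivity) (by norm_num)]
    linarith

/-- **Truncation error.**  If `0 ≤ φ ≤ 1` and `φ = 1` on `[ε, U]` (`ε > 0`), then for
`Re w = η > 0`: `‖∫₀^∞ (1 - φ(u)) e^{-2ηu} e^{-wu} du‖ ≤ e·ε + e^{-2ηU}/η`, from the pointwise bound
`(1 - φ(u)) e^{-3ηu} ≤ e^{1 - u/ε} + e^{-2ηU} e^{-ηu}` on `u > 0` (cases `u ≤ ε`, `ε < u ≤ U`,
`u > U`). [folklore] -/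
theorem torusLow_trunc_error {φ : ℝ → ℝ} (h0 : ∀ u, 0 ≤ φ u) (h1 : ∀ u, φ u ≤ 1) {ε U η : ℝ}
    (hε : 0 < ε) (hplateau : ∀ u ∈ Icc ε U, φ u = 1) (hη : 0 < η) {w : ℂ} (hw : w.re = η) :
    ‖∫ u in Ioi (0 : ℝ), (((1 - φ u) * Real.exp (-(2 * η * u)) : ℝ) : ℂ) *
        Complex.exp (-(w * (u : ℂ)))‖ ≤ Real.exp 1 * ε + Real.exp (-(2 * η * U)) / η := by
  set g : ℝ → ℝ := fun u ↦ Real.exp 1 * Real.exp (-ε⁻¹ * u) +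
    Real.exp (-(2 * η * U)) * Real.exp (-η * u) with hg
  have hi1 : IntegrableOn (fun u : ℝ ↦ Real.exp (-ε⁻¹ * u)) (Ioi 0) :=
    exp_neg_integrableOn_Ioi 0 (inv_pos.2 hε)
  have hi2 : IntegrableOn (fun u : ℝ ↦ Real.exp (-η * u)) (Ioi 0) := exp_neg_integrableOn_Ioi 0 hη
  have hgi : IntegrableOn g (Ioi 0) := (hi1.const_mul _).add (hi2.const_mul _)
  have hgv : ∫ u in Ioi (0 : ℝ), g u = Real.exp 1 * ε + Real.exp (-(2 * η * U)) / η := by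
    rw [hg, integral_add (hi1.const_mul _) (hi2.const_mul _), integral_const_mul,
      integral_const_mul, integral_exp_mul_Ioi (by simp [hε] : -ε⁻¹ < 0) 0,
      integral_exp_mul_Ioi (by linarith : -η < 0) 0]
    simp only [mul_zero, Real.exp_zero]
    field_simp
  rw [← hgv]
  refine norm_integral_le_of_norm_le hgi ((ae_restrict_mem measurableSet_Ioi).mono fun u hu ↦ ?_)
  have hu : (0 : ℝ) < u := hu
  rw [norm_mul, Complex.norm_real, loc_norm_cexp_neg_mul, hw, Real.norm_eq_abs, abs_mul,
    abs_of_nonneg (sub_nonneg.2 (h1 u)), Real.abs_exp]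
  have hA : 0 ≤ Real.exp 1 * Real.exp (-ε⁻¹ * u) := by positivity
  have hB : 0 ≤ Real.exp (-(2 * η * U)) * Real.exp (-η * u) := by positivity
  by_cases hue : u ≤ ε
  · -- `u ≤ ε`: the integrand is `≤ 1 ≤ e^{1 - u/ε}`
    have hle1 : (1 - φ u) * Real.exp (-(2 * η * u)) * Real.exp (-(η * u)) ≤ 1 := by
      have e1 : Real.exp (-(2 * η * u)) ≤ 1 := Real.exp_le_one_iff.2 (by nlinarith)
      have e2 : Real.exp (-(η * u)) ≤ 1 := Real.exp_le_one_iff.2 (by nlinarith)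
      calc (1 - φ u) * Real.exp (-(2 * η * u)) * Real.exp (-(η * u)) ≤ 1 * 1 * 1 := by
            gcongr
            linarith [h0 u]
        _ = 1 := by ring
    have hge1 : 1 ≤ Real.exp 1 * Real.exp (-ε⁻¹ * u) := by
      rw [← Real.exp_add]
      have : ε⁻¹ * u ≤ 1 := by rw [inv_mul_le_iff₀ hε]; linarith
      exact Real.one_le_exp (by linarith)
    simp only [hg]
    linarith
  · by_cases huU : u ≤ U
    · rw [hplateau u ⟨le_of_lt (not_le.1 hue), huU⟩, sub_self, zero_mul, zero_mul]
      simp only [hg]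
      linarith
    · -- `u > U`: the integrand is `≤ e^{-3ηu} ≤ e^{-2ηU} e^{-ηu}`
      have hle : (1 - φ u) * Real.exp (-(2 * η * u)) * Real.exp (-(η * u)) ≤
          Real.exp (-(2 * η * U)) * Real.exp (-η * u) := by
        calc (1 - φ u) * Real.exp (-(2 * η * u)) * Real.exp (-(η * u))
            ≤ 1 * Real.exp (-(2 * η * U)) * Real.exp (-(η * u)) := by
              gcongr
              · linarith [h0 u]
              · linarith [not_le.1 huU]
          _ = Real.exp (-(2 * η * U)) * Real.exp (-η * u) := by rw [neg_mul]; ring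
      simp only [hg]
      linarith

end Summit.RiemannHypothesis.RiemannHypothesis.Theorems.WeilParityOffLineParityDetection

end
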